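import Summits.QuantumFields.YangMills.Theses.LuscherReduction

/-!
# Route LuscherReduction — the assembly item, closed by the route's deciding theorem

`Summit.QuantumFields.YangMills.Theses.LuscherReduction.Assembly` is the registered assembly statement
`RunningReduction → OneSiteLevels → FemtoGapOfRecord` (item stmt-QuantumFields-19906, rank 1 of
route-QuantumFields-LuscherReduction) — in the route file's own words, the same implication as the deciding theorem
`closes`, whose content is the seam `femtoGapOfRecord_of_reduction` proved (sorry-free) in
`Summits/QuantumFields/YangMills/Theorems/FemtoTransferGapReduction.lean`.  This file records that fact as a
sorry-free term so the item closes by name.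
HONEST FRAMING: pure bookkeeping — the two cruxes (RED `RunningReduction`, ONE `OneSiteLevels`) remain the route's
entire open content and nothing here bears on either of them; the conclusion is the rung leaf `FemtoGapOfRecord`
(R2b1), never the summit statement.
-/

namespace Summit.QuantumFields.YangMills.Theorems

/-- The assembly item of route LuscherReduction: the cruxes RED (`RunningReduction`) and ONE (`OneSiteLevels`) imply
the rung leaf `FemtoGapOfRecord` — by the route's deciding theorem `LuscherReduction.closes`
(= `FemtoTransferGap.femtoGapOfRecord_of_reduction`). -/
theorem LuscherReduction_Assembly_proof :
    Summit.QuantumFields.YangMills.Theses.LuscherReduction.Assembly := by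
  unfold Summit.QuantumFields.YangMills.Theses.LuscherReduction.Assembly
  intro hRed hOS
  exact Summit.QuantumFields.YangMills.Theses.LuscherReduction.closes hRed hOS

end Summit.QuantumFields.YangMills.Theorems
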